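import Literature.AlgebraicGeometry.Morphisms.DevissageClass
import Literature.AlgebraicGeometry.Modules.IdealSheafNoetherian
import Mathlib.AlgebraicGeometry.IdealSheaf.Subscheme
import HarnessLib

/-!
# Dévissage, integral case: modules which are torsion at the generic point

Step (iii) of Görtz–Wedhorn I, Lemma 12.63 begins: "To show that `𝓕` is in `𝒦` we may assume that
`Supp 𝓕 = X` by induction hypothesis." In our setting (a coherent module `M` on the ambient scheme
`X` annihilated by the ideal sheaf `𝒥` of the integral closed subscheme `Z`), this is the case of
GENERIC RANK ZERO: if, on some affine open `W`, a function `b` which does not vanish identically on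
`Z ∩ W` acts nilpotently on every section of `M` over `W`, then `M` vanishes on `D(b)`, hence — by the
annihilator bound of `Modules/Annihilator` — is annihilated by `𝒥 + 𝓘ⁿ` for the ideal `𝓘` of the
closed set `X ∖ D(b)`, an ideal sheaf strictly larger than `𝒥`; so `M ∈ 𝒦` by the induction
hypothesis of the dévissage.

* `lt_sup_vanishingIdeal_pow` — `𝒥 < 𝒥 + 𝓘(T)ⁿ` for a proper radical `𝒥` whose support is not inside `T`;
* `sections_eq_zero_of_pow_smul_eq_zero` — vanishing of `M` on `D(b)`;
* `inK_of_generic_torsion` — the rank-zero case.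

Everything is proved; no named facts.

## References

* U. Görtz, T. Wedhorn, *Algebraic Geometry I: Schemes*, 2nd ed. (2020): Lemma 12.63 (iii), p. 437.
  [GortzWedhorn2020]
-/

noncomputable section

open CategoryTheory CategoryTheory.Limits AlgebraicGeometry TopologicalSpace Opposite
open Literature.AlgebraicGeometry.Modules

universe u v

namespace Literature.AlgebraicGeometry.Morphisms

variable {X : Scheme.{u}}

/-- **`𝒥 < 𝒥 + 𝓘(T)ⁿ`** for a proper radical ideal sheaf `𝒥` whose support is not contained in the
closed set `T`. [folklore] -/
theorem lt_sup_vanishingIdeal_pow {J : X.IdealSheafData} (hJtop : J ≠ ⊤) (hJrad : J.radical = J)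
    {T : Closeds X} (hT : ¬ ((J.support : Set X) ⊆ (T : Set X))) (n : ℕ) :
    J < J ⊔ Scheme.IdealSheafData.vanishingIdeal T ^ n := by
  refine lt_of_le_of_ne le_sup_left fun h => ?_
  have hIJ : Scheme.IdealSheafData.vanishingIdeal T ^ n ≤ J := le_sup_right.trans h.symm.le
  rcases Nat.eq_zero_or_pos n with h0 | hpos
  · rw [h0, pow_zero, Scheme.IdealSheafData.one_eq_top] at hIJ
    exact hJtop (top_le_iff.mp hIJ)
  have hIJ' : Scheme.IdealSheafData.vanishingIdeal T ≤ J := by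
    refine Scheme.IdealSheafData.le_def.mpr fun W => ?_
    have h1 : (Scheme.IdealSheafData.vanishingIdeal T).ideal W ^ n ≤ J.ideal W := by
      have := Scheme.IdealSheafData.le_def.mp hIJ W
      rwa [Scheme.IdealSheafData.ideal_pow] at this
    have h2 : J.ideal W = (J.ideal W).radical := by
      have := congrFun (congrArg Scheme.IdealSheafData.ideal hJrad) W
      rw [Scheme.IdealSheafData.radical_ideal] at this
      exact this.symm
    calc (Scheme.IdealSheafData.vanishingIdeal T).ideal W
        ≤ ((Scheme.IdealSheafData.vanishingIdeal T).ideal W ^ n).radical := by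
          rw [Ideal.radical_pow _ hpos.ne']; exact Ideal.le_radical
      _ ≤ (J.ideal W).radical := Ideal.radical_mono h1
      _ = J.ideal W := h2.symm
  apply hT
  have := Scheme.IdealSheafData.support_antitone hIJ'
  rw [← Scheme.IdealSheafData.coe_support_vanishingIdeal T]
  exact this

/-- For `g` in the ideal of the closed set `X ∖ D(b)`, `D(g) ⊆ D(b)`. [folklore] -/
theorem basicOpen_le_of_mem_vanishingIdeal_compl {W V : X.Opens} (b : Γ(X, W)) (hV : IsAffineOpen V)
    {g : Γ(X, V)}
    (hg : g ∈ (Scheme.IdealSheafData.vanishingIdeal ⟨((X.basicOpen b : X.Opens) : Set X)ᶜ,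
      (X.basicOpen b).isOpen.isClosed_compl⟩).ideal ⟨V, hV⟩) :
    X.basicOpen g ≤ X.basicOpen b := by
  intro x hx
  by_contra hxb
  have hmem : x ∈ ((Scheme.IdealSheafData.vanishingIdeal ⟨((X.basicOpen b : X.Opens) : Set X)ᶜ,
      (X.basicOpen b).isOpen.isClosed_compl⟩).support : Set X) := by
    rw [Scheme.IdealSheafData.coe_support_vanishingIdeal]; exact hxb
  have h3 := Scheme.IdealSheafData.mem_support_iff.mp hmem ⟨V, hV⟩
  rw [Scheme.mem_zeroLocus_iff] at h3
  exact h3 g hg hx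

/-- **If `b ∈ Γ(W, 𝒪_X)` acts nilpotently on every section of the affine-localizing `M` over the affine
`W`, then `M` has no non-zero sections over opens inside `D(b)`.** [folklore] -/
theorem sections_eq_zero_of_pow_smul_eq_zero {M : X.Modules} (hM : IsAffineLocalizing M) {W : X.Opens}
    (hW : IsAffineOpen W) (b : Γ(X, W)) (hb : ∀ m : Γ(M, W), ∃ k : ℕ, b ^ k • m = 0)
    {V : X.Opens} (hVb : V ≤ X.basicOpen b) (m : Γ(M, V)) : m = 0 := by
  have hVW : V ≤ W := hVb.trans (X.basicOpen_le b)
  -- sections over the principal opens `D(h) ⊆ V` of `W` vanish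
  have hbasic : ∀ (h : Γ(X, W)) (hhV : X.basicOpen h ≤ V) (m' : Γ(M, X.basicOpen h)), m' = 0 := by
    intro h hhV m'
    obtain ⟨N, x, hx⟩ := hM.numerator hW h rfl m'
    obtain ⟨k, hk⟩ := hb x
    -- `b` is a unit on `D(h) ⊆ D(b)`, and `b^k h^N m' = (b^k x)| = 0`
    have hu : IsUnit (X.presheaf.map (homOfLE (hhV.trans hVb)).op
        (X.presheaf.map (homOfLE (X.basicOpen_le b)).op b)) :=
      (X.toRingedSpace.isUnit_res_basicOpen b).map _
    have hu' : IsUnit (X.presheaf.map (homOfLE (X.basicOpen_le h)).op b) := by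
      rw [← CategoryTheory.comp_apply, ← Functor.map_comp] at hu
      exact (congrArg (fun φ => IsUnit (X.presheaf.map φ b)) (Subsingleton.elim _ _)).mp hu
    have hh : IsUnit (X.presheaf.map (homOfLE (X.basicOpen_le h)).op h) :=
      X.toRingedSpace.isUnit_res_basicOpen h
    refine (IsUnit.smul_left_cancel ((hu'.pow k).mul (hh.pow N))).mp ?_
    rw [smul_zero, mul_smul, ← hx, ← map_pow, ← Scheme.Modules.map_smul, hk, map_zero]
  -- cover `V` by such principal opens
  let K : Type u := {h : Γ(X, W) // X.basicOpen h ≤ V}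
  have hcov : V ≤ ⨆ k : K, X.basicOpen k.1 := by
    intro x hx
    obtain ⟨h, hhV, hxh⟩ := hW.exists_basicOpen_le (V := V) ⟨x, hx⟩ (hVW hx)
    exact Opens.mem_iSup.mpr ⟨⟨h, hhV⟩, hxh⟩
  refine (abSheafOf M).eq_of_locally_eq' (fun k : K => X.basicOpen k.1) V (fun k => homOfLE k.2) hcov m 0
    fun k => ?_
  rw [map_zero]
  exact hbasic k.1 k.2 _

variable {A : Type u} [CommRing A] [IsLocallyNoetherian X] [CompactSpace X]
  {f : X ⟶ Spec (.of A)} {κ : Type v} {U : κ → X.Opens}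

/-- **The rank-zero case of the integral step of the dévissage.** Let `𝒥` be a proper radical ideal
sheaf, `M` coherent with `𝒥 M = 0`, and suppose that on some affine open `W` a function `b` that
does not vanish on the whole of `V(𝒥) ∩ W` acts nilpotently on all sections of `M` over `W`. If the
dévissage claim holds for all ideal sheaves `> 𝒥`, then `M ∈ 𝒦`.
[cite: GortzWedhorn2020, Lemma 12.63 (iii) (p. 437)] -/
theorem inK_of_generic_torsion {J : X.IdealSheafData} (hJtop : J ≠ ⊤) (hJrad : J.radical = J)
    (ih : ∀ J' > J, ∀ M : X.Modules, Coh M → IsKilledBy J' M → InK f U M)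
    {M : X.Modules} (hM : Coh M) (hJM : IsKilledBy J M) {W : X.Opens} (hW : IsAffineOpen W)
    (b : Γ(X, W)) (hbZ : ∃ x ∈ X.basicOpen b, x ∈ (J.support : Set X))
    (hb : ∀ m : Γ(M, W), ∃ k : ℕ, b ^ k • m = 0) : InK f U M := by
  classical
  let T : Closeds X := ⟨((X.basicOpen b : X.Opens) : Set X)ᶜ, (X.basicOpen b).isOpen.isClosed_compl⟩
  obtain ⟨t, ht⟩ := exists_finite_affineOpens_iSup_eq_top (X := X)
  obtain ⟨n, hn⟩ := exists_isKilledBy_sup_pow J hM.loc hM.ft (fun V : t => (V : X.affineOpens)) ht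
    (I := Scheme.IdealSheafData.vanishingIdeal T) hJM fun k g hg m =>
      sections_eq_zero_of_pow_smul_eq_zero hM.loc hW b hb
        (basicOpen_le_of_mem_vanishingIdeal_compl b (k : X.affineOpens).2 hg) _
  have hT : ¬ ((J.support : Set X) ⊆ (T : Set X)) := fun h => by
    obtain ⟨x, hxb, hxJ⟩ := hbZ
    exact h hxJ hxb
  exact ih _ (lt_sup_vanishingIdeal_pow hJtop hJrad hT n) M hM hn

end Literature.AlgebraicGeometry.Morphisms

end
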